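import Summits.KontsevichZagierPeriods.KontsevichZagierPeriods.Theorems.TerasomaMultiplicationReflectionThirdMoves

/-!
# `ReflectionThird` (stmt-KontsevichZagierPeriods-12307) — the moves, II

Continuation of `…ReflectionThirdMoves.lean`: the last two rule-2 links of the chain,

* `arcRep_sub_lineRep_mem`      — `[{3t²<1}, 3/(1+t²)] − [ℝ, 1/(1+T²)]`, `T = (3t-t³)/(1-3t²) = tan(3 arctan t)`
  (onto `ℝ` by the intermediate value theorem, injective since its derivative `3(1+t²)²/(1-3t²)²`
  is positive on the interval `{3t² < 1}`);
* `lineRep_sub_invSqrtRep_mem`  — `[ℝ, 1/(1+T²)] − [(-1,1), 1/√(1-x²)]`, `x = T/√(1+T²)`.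

References: M. Kontsevich, D. Zagier, *Periods* (2001), §1.1–1.2; G. Andrews, R. Askey, R. Roy,
*Special Functions* (1999), §1.2.
-/

noncomputable section

set_option linter.dupNamespace false

open MeasureTheory Set
open Literature.NumberTheory.Transcendental
open Literature.NumberTheory.Transcendental.KZ
open Literature.ModelTheory.ExponentialFields (IsSemialgebraic isSemialgebraic_univ)
open MvPolynomial (aeval X C)
open Literature.NumberTheory.Transcendental.KZreg (unitIoo isSemialgebraic_unitIoo)
open Summit.KontsevichZagierPeriods.KontsevichZagierPeriods.BetaCancellationNegative
  (symIoo isSemialgebraic_symIoo mem_symIoo invSqrtRep invSqrtRep_domain invSqrtRep_integrand_eq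
    isSemialgebraicFunOn_of_eqOn_inv_sqrt volume_setOf_apply_eq_zero)
open Summit.KontsevichZagierPeriods.HermiteRigidity.GenusTwoCycleTransfer
  (hasFDerivAt_fin_one det_smul_id_fin_one)

namespace Summit.KontsevichZagierPeriods.KontsevichZagierPeriods.Theorems.ReflectionThird

/-! ### Move 7 (rule 2): the tripling map `T = (3t-t³)/(1-3t²) = tan(3 arctan t)` -/

/-- `d/dt (3t-t³)/(1-3t²) = 3(1+t²)²/(1-3t²)²` where `1 - 3t² ≠ 0`. [folklore] -/
theorem hasDerivAt_trip {t : ℝ} (ht : 1 - 3 * t ^ 2 ≠ 0) : HasDerivAt trip (tripDeriv t) t := by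
  have hp3 : HasDerivAt (fun s : ℝ => s ^ 3) (3 * t ^ 2) t := by
    simpa using hasDerivAt_pow 3 t
  have hp2 : HasDerivAt (fun s : ℝ => s ^ 2) (2 * t) t := by
    simpa using hasDerivAt_pow 2 t
  have hf : HasDerivAt (fun s : ℝ => 3 * s - s ^ 3) (3 * 1 - 3 * t ^ 2) t :=
    ((hasDerivAt_id' t).const_mul 3).sub hp3
  have hg : HasDerivAt (fun s : ℝ => 1 - 3 * s ^ 2) (-(3 * (2 * t))) t :=
    (hp2.const_mul 3).const_sub 1
  have h := hf.div hg ht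
  refine h.congr_deriv ?_
  rw [tripDeriv, div_eq_div_iff (pow_ne_zero 2 ht) (pow_ne_zero 2 ht)]
  ring

/-- `0 < 3(1+t²)²/(1-3t²)²` where `1 - 3t² ≠ 0`. [folklore] -/
theorem tripDeriv_pos {t : ℝ} (ht : 1 - 3 * t ^ 2 ≠ 0) : 0 < tripDeriv t := by
  unfold tripDeriv
  have : 0 < (1 - 3 * t ^ 2) ^ 2 := by positivity
  positivity

/-- `{t | 3t² < 1}` is order-connected (an interval). [folklore] -/
theorem ordConnected_setOf_three_mul_sq_lt : OrdConnected {t : ℝ | 3 * t ^ 2 < 1} := by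
  refine ⟨fun x hx y hy z hz => ?_⟩
  simp only [mem_setOf_eq] at hx hy ⊢
  rcases le_or_gt 0 z with h0 | h0
  · have : z ^ 2 ≤ y ^ 2 := pow_le_pow_left₀ h0 hz.2 2
    linarith
  · have : z ^ 2 ≤ x ^ 2 := by
      have h1 : 0 ≤ -z := by linarith
      have h2 : -z ≤ -x := by linarith [hz.1]
      have := pow_le_pow_left₀ h1 h2 2
      simpa [neg_sq] using this
    linarith

/-- The tripling map is strictly increasing on `{3t² < 1}` (positive derivative on an interval).
[folklore] -/
theorem strictMonoOn_trip : StrictMonoOn trip {t : ℝ | 3 * t ^ 2 < 1} := by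
  have hD : Convex ℝ {t : ℝ | 3 * t ^ 2 < 1} := ordConnected_setOf_three_mul_sq_lt.convex
  refine strictMonoOn_of_deriv_pos hD ?_ ?_
  · intro t ht
    have ht' : 1 - 3 * t ^ 2 ≠ 0 := by simp only [mem_setOf_eq] at ht; linarith
    exact (hasDerivAt_trip ht').continuousAt.continuousWithinAt
  · intro t ht
    have ht' : 1 - 3 * t ^ 2 ≠ 0 := by
      have := interior_subset ht
      simp only [mem_setOf_eq] at this
      linarith
    rw [(hasDerivAt_trip ht').deriv]
    exact tripDeriv_pos ht'

/-- The tripling map sends `{3t² < 1}` ONTO `ℝ` (intermediate value theorem on `[-1/√3, 1/√3]`,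
where the denominator vanishes at the end points). [folklore] -/
theorem exists_trip_eq (T : ℝ) : ∃ t : ℝ, 3 * t ^ 2 < 1 ∧ trip t = T := by
  set a : ℝ := √3 / 3 with ha_def
  have ha2 : a ^ 2 = 1 / 3 := by
    rw [ha_def, div_pow, Real.sq_sqrt (by norm_num : (0:ℝ) ≤ 3)]
    norm_num
  have ha0 : 0 < a := by rw [ha_def]; exact div_pos sqrt3_pos (by norm_num)
  set P : ℝ → ℝ := fun t => (3 * t - t ^ 3) - T * (1 - 3 * t ^ 2) with hP_def
  have hPc : ContinuousOn P (Icc (-a) a) := by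
    rw [hP_def]
    fun_prop
  have hPa : P a = 8 * a / 3 := by
    have h3 : a ^ 3 = a * a ^ 2 := by ring
    simp only [hP_def, h3, ha2]
    ring
  have hPna : P (-a) = -(8 * a / 3) := by
    have h3 : (-a) ^ 3 = -(a * a ^ 2) := by ring
    have h2 : (-a) ^ 2 = a ^ 2 := by ring
    simp only [hP_def, h3, h2, ha2]
    ring
  have h0 : (0:ℝ) ∈ Ioo (P (-a)) (P a) := by
    rw [hPa, hPna, mem_Ioo]
    constructor <;> linarith
  obtain ⟨t, ht, hPt⟩ := intermediate_value_Ioo (by linarith) hPc h0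
  have ht2 : t ^ 2 < a ^ 2 := sq_lt_sq' ht.1 ht.2
  have ht3 : 3 * t ^ 2 < 1 := by rw [ha2] at ht2; linarith
  refine ⟨t, ht3, ?_⟩
  have hne : 1 - 3 * t ^ 2 ≠ 0 := by linarith
  rw [trip, div_eq_iff hne]
  have : (3 * t - t ^ 3) - T * (1 - 3 * t ^ 2) = 0 := hPt
  linarith

/-- `tripMap` sends `{3t² < 1}` onto `ℝ¹`. [folklore] -/
theorem image_tripMap_jDom : tripMap '' jDom = univ := by
  refine eq_univ_of_forall fun y => ?_
  obtain ⟨t, ht, hty⟩ := exists_trip_eq (y 0)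
  exact ⟨fun _ => t, by simpa using ht, eq_of_apply_zero_eq (by simp [tripMap, hty])⟩

/-- The Jacobian identity of move 7: `3/(1+t²) = (1 + trip(t)²)⁻¹ · 3(1+t²)²/(1-3t²)²`
(`(1-3t²)² + (3t-t³)² = (1+t²)³`). [folklore] -/
theorem trip_jacobian {t : ℝ} (ht : 1 - 3 * t ^ 2 ≠ 0) :
    3 / (1 + t ^ 2) = (1 + trip t ^ 2)⁻¹ * tripDeriv t := by
  have h1 : (1:ℝ) + t ^ 2 ≠ 0 := by positivity
  have h2 : (1:ℝ) + trip t ^ 2 ≠ 0 := by positivity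
  have h3 : (1 - 3 * t ^ 2) ^ 2 ≠ 0 := pow_ne_zero 2 ht
  rw [eq_inv_mul_iff_mul_eq₀ h2]
  simp only [trip, tripDeriv]
  field_simp
  ring

/-- **Move 7**: `[{3t²<1}, 3/(1+t²)] − [ℝ, 1/(1+T²)]` is ONE change-of-variables move
(`T = (3t-t³)/(1-3t²)`). [cite: AndrewsAskeyRoy1999, §1.2] -/
theorem arcRep_sub_lineRep_mem : of arcRep - of lineRep ∈ changeOfVariablesRel := by
  refine ⟨1, arcRep, lineRep, tripMap, tripMapDeriv, ?_, ?_, ?_, image_tripMap_jDom.symm, ?_, rfl⟩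
  · refine IsSemialgebraicMapOn.of_forall isSemialgebraic_jDom fun _ => ?_
    refine (isSemialgebraicFunOn_aeval_div_aeval isSemialgebraic_jDom
      (3 * X 0 - X 0 ^ 3 : MvPolynomial (Fin 1) ℚ) (1 - 3 * X 0 ^ 2) fun x hx => ?_).congr
      fun x _ => ?_
    · simp only [mem_jDom] at hx
      simp only [map_sub, map_one, map_mul, map_pow, MvPolynomial.aeval_X, map_ofNat]
      linarith
    · simp [tripMap, trip]
  · intro x hx
    simp only [arcRep_domain, mem_jDom] at hx
    exact (hasFDerivAt_fin_one trip _ x (hasDerivAt_trip (by linarith))).hasFDerivWithinAt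
  · intro x hx y hy h
    have h0 : trip (x 0) = trip (y 0) := congrFun h 0
    exact eq_of_apply_zero_eq (strictMonoOn_trip.injOn hx hy h0)
  · intro x hx
    simp only [arcRep_domain, mem_jDom] at hx
    have hne : 1 - 3 * x 0 ^ 2 ≠ 0 := by linarith
    rw [tripMapDeriv, abs_det_smul_id, abs_of_pos (tripDeriv_pos hne)]
    simp only [arcRep_integrand, lineRep_integrand, tripMap]
    exact trip_jacobian hne

/-! ### Move 8 (rule 2): `x = T/√(1+T²)` onto `(-1,1)` -/

/-- `0 < √(1 + T²)`. [folklore] -/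
theorem sqrt_one_add_sq_pos (T : ℝ) : 0 < √(1 + T ^ 2) := Real.sqrt_pos.2 (by positivity)

/-- `d/dT T/√(1+T²) = 1/((1+T²)√(1+T²))`. [folklore] -/
theorem hasDerivAt_sinOfTan (T : ℝ) : HasDerivAt sinOfTan (sinOfTanDeriv T) T := by
  have hu : HasDerivAt (fun s : ℝ => 1 + s ^ 2) (2 * T) T := by
    simpa using (hasDerivAt_pow 2 T).const_add 1
  have hpos : (0:ℝ) < 1 + T ^ 2 := by positivity
  have hs := hu.sqrt hpos.ne'
  have h := (hasDerivAt_id T).div hs (sqrt_one_add_sq_pos T).ne'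
  refine h.congr_deriv ?_
  set s := √(1 + T ^ 2) with hs_def
  have hs0 : s ≠ 0 := (sqrt_one_add_sq_pos T).ne'
  have hsq : s ^ 2 = 1 + T ^ 2 := by rw [hs_def, Real.sq_sqrt hpos.le]
  rw [sinOfTanDeriv, ← hsq]
  field_simp
  rw [id, hsq]
  ring

/-- `0 < 1/((1+T²)√(1+T²))`. [folklore] -/
theorem sinOfTanDeriv_pos (T : ℝ) : 0 < sinOfTanDeriv T := by
  unfold sinOfTanDeriv
  exact inv_pos.2 (mul_pos (by positivity) (sqrt_one_add_sq_pos T))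

/-- `sinOfTan` is strictly increasing. [folklore] -/
theorem strictMono_sinOfTan : StrictMono sinOfTan :=
  strictMono_of_deriv_pos fun T => by
    rw [(hasDerivAt_sinOfTan T).deriv]
    exact sinOfTanDeriv_pos T

/-- `1 - (T/√(1+T²))² = (1+T²)⁻¹`. [folklore] -/
theorem one_sub_sinOfTan_sq (T : ℝ) : 1 - sinOfTan T ^ 2 = (1 + T ^ 2)⁻¹ := by
  rw [sinOfTan, div_pow, Real.sq_sqrt (by positivity : (0:ℝ) ≤ 1 + T ^ 2)]
  field_simp
  ring

/-- `|T/√(1+T²)| < 1`. [folklore] -/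
theorem sinOfTan_mem_Ioo (T : ℝ) : sinOfTan T ∈ Ioo (-1:ℝ) 1 := by
  have h : sinOfTan T ^ 2 < 1 := by
    have := one_sub_sinOfTan_sq T
    have h2 : 0 < (1 + T ^ 2)⁻¹ := inv_pos.2 (by positivity)
    linarith
  have := abs_lt.1 ((sq_lt_one_iff_abs_lt_one _).1 h)
  exact ⟨this.1, this.2⟩

/-- `sinOfTan (x/√(1-x²)) = x` for `|x| < 1`. [folklore] -/
theorem sinOfTan_div_sqrt {x : ℝ} (hx : x ∈ Ioo (-1:ℝ) 1) : sinOfTan (x / √(1 - x ^ 2)) = x := by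
  have hpos : 0 < 1 - x ^ 2 := by nlinarith [hx.1, hx.2]
  set s := √(1 - x ^ 2) with hs_def
  have hs0 : 0 < s := Real.sqrt_pos.2 hpos
  have hsq : s ^ 2 = 1 - x ^ 2 := by rw [hs_def, Real.sq_sqrt hpos.le]
  have h1 : 1 + (x / s) ^ 2 = (s ^ 2)⁻¹ := by
    rw [div_pow, hsq]
    field_simp
    ring
  rw [sinOfTan, h1, Real.sqrt_inv, Real.sqrt_sq hs0.le]
  field_simp

/-- `sinOfTanMap` sends `ℝ¹` onto `(-1,1)`. [folklore] -/
theorem image_sinOfTanMap_univ : sinOfTanMap '' univ = symIoo := by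
  ext y
  constructor
  · rintro ⟨x, -, rfl⟩
    simpa [sinOfTanMap] using sinOfTan_mem_Ioo (x 0)
  · intro hy
    rw [mem_symIoo] at hy
    exact ⟨fun _ => y 0 / √(1 - y 0 ^ 2), mem_univ _,
      eq_of_apply_zero_eq (by simp [sinOfTanMap, sinOfTan_div_sqrt hy])⟩

/-- The Jacobian identity of move 8: `1/(1+T²) = (√(1 - sinOfTan(T)²))⁻¹ · 1/((1+T²)√(1+T²))`.
[folklore] -/
theorem sinOfTan_jacobian (T : ℝ) :
    (1 + T ^ 2)⁻¹ = (√(1 - sinOfTan T ^ 2))⁻¹ * sinOfTanDeriv T := by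
  rw [one_sub_sinOfTan_sq, Real.sqrt_inv, inv_inv, sinOfTanDeriv]
  have h1 : (1:ℝ) + T ^ 2 ≠ 0 := by positivity
  have h2 := (sqrt_one_add_sq_pos T).ne'
  field_simp

/-- **Move 8**: `[ℝ, 1/(1+T²)] − [(-1,1), 1/√(1-x²)]` is ONE change-of-variables move
(`x = T/√(1+T²)`). [cite: KontsevichZagier2001, §1.1] -/
theorem lineRep_sub_invSqrtRep_mem : of lineRep - of invSqrtRep ∈ changeOfVariablesRel := by
  refine ⟨1, lineRep, invSqrtRep, sinOfTanMap, sinOfTanMapDeriv, ?_, ?_, ?_, ?_, ?_, rfl⟩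
  · refine IsSemialgebraicMapOn.of_forall isSemialgebraic_univ fun _ => ?_
    have hX := isSemialgebraicFunOn_coord (isSemialgebraic_univ (k := ℚ) (ι := Fin 1) (R := ℝ))
    have hS : IsSemialgebraicFunOn ℚ (univ : Set (Fin 1 → ℝ)) (fun x => (√(1 + x 0 ^ 2))⁻¹) :=
      isSemialgebraicFunOn_of_eqOn_inv_sqrt isSemialgebraic_univ (1 + X 0 ^ 2)
        (fun x _ => by
          simp only [map_add, map_one, map_pow, MvPolynomial.aeval_X]
          positivity)
        (fun x _ => by simp)
    exact (hX.fun_mul hS).congr fun x _ => by simp [sinOfTanMap, sinOfTan, div_eq_mul_inv]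
  · intro x _
    exact (hasFDerivAt_fin_one sinOfTan _ x (hasDerivAt_sinOfTan (x 0))).hasFDerivWithinAt
  · intro x _ y _ h
    have h0 : sinOfTan (x 0) = sinOfTan (y 0) := congrFun h 0
    exact eq_of_apply_zero_eq (strictMono_sinOfTan.injective h0)
  · rw [invSqrtRep_domain, lineRep_domain, image_sinOfTanMap_univ]
  · intro x _
    have hmem : sinOfTanMap x ∈ symIoo := by
      simpa [sinOfTanMap] using sinOfTan_mem_Ioo (x 0)
    rw [invSqrtRep_integrand_eq hmem, sinOfTanMapDeriv, abs_det_smul_id,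
      abs_of_pos (sinOfTanDeriv_pos (x 0))]
    simp only [lineRep_integrand, sinOfTanMap]
    exact sinOfTan_jacobian (x 0)

end Summit.KontsevichZagierPeriods.KontsevichZagierPeriods.Theorems.ReflectionThird

end
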